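import Literature.Geometry.Riemannian.SphericalCapMap
import Literature.Geometry.Riemannian.RoundSphereProofs
import Literature.Geometry.Lorentzian.SecondFundamentalFormApply
import Literature.Geometry.Lorentzian.CoordinateFrames
import HarnessLib

/-!
# Spherical caps are umbilic: the radial normal field of the gnomonic caps and its covariant derivative
(topic `Geometry/Riemannian`)

Second file of the infrastructure for the disc case of
`Literature.Geometry.Riemannian.Sweeney2026_pscMeanConvex` (Sweeney 2026, Prop. 1.2), after
`SphericalCapMap.lean` (the gnomonic cap map `Φ = capMap v : ℝⁿ⁺¹ → Sⁿ⁺¹` about `-v` and its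
chart `capInv`). Everything is PROVED:

* `capNormal v` — the **radial field of the caps**, a tangent vector field of `Sⁿ⁺¹`: at
  `y = Φ(x)` it is `dΦₓ(2x)` (junk outside the open hemisphere about `-v`); along the image of the
  unit sphere `‖x‖ = 1` (the boundary of the cap of angular radius `π/4`) it is the outward unit
  normal. It is smooth on the open hemisphere (`contMDiffAt_capNormal`: the bundled derivative
  `tangentMap Φ` applied to the smooth `Tℝⁿ⁺¹`-valued map `y ↦ (Φ⁻¹ y, 2Φ⁻¹ y)`).
* `capField v p = -2⟪v, p⟫ (v - ⟪v, p⟫ p)` — a polynomial vector field on `V` which, read through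
  `dι`, extends the radial field: `dι (N (Φ x)) = capField (Φ x) = 2ρ⁻³ (e x + ‖x‖² v)`
  (`mvfderiv_coe_capNormal_capMap`).
* `leviCivita_capNormal` — **umbilicity**: for the Levi-Civita connection of the round metric
  (`roundMetric`, `RoundSphere.lean`), at a point `y` of the open hemisphere and for a tangent
  vector `a` with `dι a ⊥ v` (tangent to the parallel through `y`), `∇ₐ N = 2⟪v, y⟫² a`. Proof
  in the ambient space, exactly as the curvature of the round sphere is computed in
  `RoundSphereProofs.lean`: `dι(∇ₐ N)` is the tangential part of the ambient derivative of
  `ι_* N = capField ∘ ι` (`mvfderiv_coe_cov_apply_sphere`, Lee 2018, Prop. 5.12 (b)), and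
  `D(capField)_y(dι a) = 2⟪v, y⟫² dι a` is already tangent. On the boundary of the cap of
  angular radius `π/4`, `2⟪v, y⟫² = 2ρ⁻² = 1`: the shape operator is the identity
  (`cot(π/4) = 1`; Lee 2018, Example 8.25 / Prop. 8.36 for geodesic spheres in spheres).
* `normalDerivAlong_comp_eq_leviCivita` — the general fact `D_w (Y ∘ f) = ∇_{df w} Y` for the
  tree's covariant derivative of a field along a map (`PseudoRiemannianMetric.normalDerivAlong`,
  `Hypersurface.lean`) and a vector field `Y` of the target (O'Neill 1983, Ch. 3,
  Prop. 3.18 (3); from `covariantDerivAlong_comp_holds`).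

## References

* P. Sweeney Jr., *Positive curvature conditions on contractible manifolds*, Math. Ann. (2026)
  = arXiv:2507.15719, Prop. 1.2. [Sweeney2026]
* J. M. Lee, *Introduction to Riemannian Manifolds*, 2nd ed. (2018), Prop. 5.12 (b),
  Example 8.25, Prop. 8.36. [Lee2018]
* B. O'Neill, *Semi-Riemannian geometry* (1983), Ch. 3, Prop. 3.18; Ch. 4, Lemma 4.1.
  [ONeill1983]
-/

noncomputable section

open Bundle Set Function Metric Module Filter
open scoped Manifold ContDiff Topology RealInnerProductSpace

namespace Literature.Geometry.Riemannian

open Lorentzian Lorentzian.PseudoRiemannianMetric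

variable {V : Type*} [NormedAddCommGroup V] [InnerProductSpace ℝ V] {n : ℕ}

/-- Local notation: the parameter space `ℝⁿ⁺¹` of the cap. -/
local notation "𝔼" => EuclideanSpace ℝ (Fin (n + 1))

/-! ### The outward normal field of the caps and its covariant derivative -/

section Normal

variable [Fact (finrank ℝ V = n + 1 + 1)] (v : sphere (0 : V) 1)

/-- **The radial field of the caps**, a tangent vector field on `Sⁿ⁺¹`: at `y = Φ(x)` in the open
hemisphere about `-v` it is `dΦₓ(2x)`, the image of twice the position field of `ℝⁿ⁺¹` under the
cap map (so that along the boundary `Φ(∂𝔻ⁿ⁺¹)` of the cap of angular radius `π/4` it is the outward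
unit normal); junk outside that hemisphere. [folklore] -/
def capNormal (y : sphere (0 : V) 1) : TangentSpace (𝓡 (n + 1)) y :=
  mfderiv 𝓘(ℝ, 𝔼) (𝓡 (n + 1)) (capMap (n := n) v) (capInv (n := n) v y)
    ((2 : ℝ) • capInv (n := n) v y)

/-- At `y = Φ(x)` the radial field is `dΦₓ(2x)`. [folklore] -/
theorem capNormal_capMap (x : 𝔼) :
    capNormal v (capMap v x) = mfderiv 𝓘(ℝ, 𝔼) (𝓡 (n + 1)) (capMap (n := n) v) x ((2 : ℝ) • x) := by
  unfold capNormal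
  rw [capInv_capMap]

/-- `DΦₓ(2x) = 2ρ⁻³ (e x + ‖x‖² v)`: the radial field at `Φ(x)` read in the ambient space. [folklore] -/
theorem capDeriv_two_smul_self (x : 𝔼) :
    capDeriv v x ((2 : ℝ) • x) =
      (2 * (capRadius (n := n) x)⁻¹ ^ 3) • (capEmb v x + ‖x‖ ^ 2 • (v : V)) := by
  rw [capDeriv_apply, inner_smul_right, real_inner_self_eq_norm_sq, map_smul, capLift]
  have hρ := capRadius_pos (n := n) x
  have h2 : ‖x‖ ^ 2 = capRadius (n := n) x ^ 2 - 1 := by rw [capRadius_sq]; ring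
  rw [h2]
  match_scalars
  · field_simp
    ring
  · field_simp

/-- **The radial field is smooth on the open hemisphere about `-v`**: there it is the bundled
derivative of the cap map applied to the smooth `Tℝⁿ⁺¹`-valued map `y ↦ (Φ⁻¹ y, 2Φ⁻¹ y)`.
[folklore] -/
theorem contMDiffAt_capNormal {y : sphere (0 : V) 1} (hy : ⟪(v : V), y⟫ < 0) :
    ContMDiffAt (𝓡 (n + 1)) (𝓡 (n + 1)).tangent ∞
      (fun y ↦ (TotalSpace.mk' 𝔼 y (capNormal (n := n) v y) :
        TangentBundle (𝓡 (n + 1)) (sphere (0 : V) 1))) y := by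
  -- the `Tℝⁿ⁺¹`-valued map `G y = (Φ⁻¹ y, 2 Φ⁻¹ y)` is smooth at `y`
  set G : sphere (0 : V) 1 → TangentBundle 𝓘(ℝ, 𝔼) 𝔼 := fun y ↦
    TotalSpace.mk' 𝔼 (capInv (n := n) v y) ((2 : ℝ) • capInv (n := n) v y) with hG_def
  have hinv : ContMDiffAt (𝓡 (n + 1)) 𝓘(ℝ, 𝔼) ∞ (fun y : sphere (0 : V) 1 ↦ capInv (n := n) v y) y :=
    (contDiffAt_capInv v hy.ne).contMDiffAt.comp y (contMDiff_coe_sphere y)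
  have hG : ContMDiffAt (𝓡 (n + 1)) 𝓘(ℝ, 𝔼).tangent ∞ G y := by
    rw [ModelWithCorners.tangent, contMDiffAt_totalSpace]
    refine ⟨hinv, ?_⟩
    simp only [hG_def, trivializationAt_model_space_apply]
    exact ((contDiffAt_capInv v hy.ne).const_smul (2 : ℝ)).contMDiffAt.comp y
      (contMDiff_coe_sphere y)
  -- compose with the bundled derivative of the cap map
  have hT := ((contMDiff_capMap (n := n) v).contMDiff_tangentMap (m := ∞) le_rfl).contMDiffAt.comp
    y hG
  -- near `y` the composite is the section `y ↦ (y, N y)`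
  refine hT.congr_of_eventuallyEq ?_
  have hopen : IsOpen {y : sphere (0 : V) 1 | ⟪(v : V), y⟫ < 0} :=
    isOpen_lt (continuous_const.inner continuous_subtype_val) continuous_const
  filter_upwards [hopen.mem_nhds hy] with y' hy'
  obtain ⟨x, rfl⟩ := exists_capMap_eq (n := n) v hy'
  simp only [comp_apply, hG_def, tangentMap]
  rw [capNormal_capMap, capInv_capMap]

/-- The smooth vector field on `V` extending the radial field across the open hemisphere:
`p ↦ -2⟪v, p⟫ (v - ⟪v, p⟫ p)`. [folklore] -/
def capField (p : V) : V := (-2 * ⟪(v : V), p⟫) • ((v : V) - ⟪(v : V), p⟫ • p)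

omit [Fact (finrank ℝ V = n + 1 + 1)] in
/-- The derivative of the polynomial field `capField` (product rule). [folklore] -/
theorem hasFDerivAt_capField (p : V) :
    HasFDerivAt (capField v) ((-2 * ⟪(v : V), p⟫) • -(⟪(v : V), p⟫ • ContinuousLinearMap.id ℝ V +
        (innerSL ℝ (v : V)).smulRight p) +
      ((-2 : ℝ) • innerSL ℝ (v : V)).smulRight ((v : V) - ⟪(v : V), p⟫ • p)) p := by
  have h1 : HasFDerivAt (fun p : V ↦ ⟪(v : V), p⟫ • p)
      (⟪(v : V), p⟫ • ContinuousLinearMap.id ℝ V + (innerSL ℝ (v : V)).smulRight p) p :=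
    (innerSL ℝ (v : V)).hasFDerivAt.smul (hasFDerivAt_id p)
  have h2 : HasFDerivAt (fun p : V ↦ -2 * ⟪(v : V), p⟫) ((-2 : ℝ) • innerSL ℝ (v : V)) p :=
    (innerSL ℝ (v : V)).hasFDerivAt.const_mul (-2)
  exact h2.smul (h1.const_sub (v : V))

omit [Fact (finrank ℝ V = n + 1 + 1)] in
/-- In directions orthogonal to `v` the extension has derivative `2⟪v, p⟫² η`. [folklore] -/
theorem fderiv_capField_apply_of_inner_eq_zero (p : V) {η : V} (hη : ⟪(v : V), η⟫ = 0) :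
    fderiv ℝ (capField v) p η = (2 * ⟪(v : V), p⟫ ^ 2) • η := by
  rw [(hasFDerivAt_capField v p).fderiv]
  simp only [add_apply, smul_apply, neg_apply, ContinuousLinearMap.smulRight_apply,
    ContinuousLinearMap.id_apply, innerSL_apply_apply, hη, zero_smul, add_zero, smul_zero,
    smul_neg, smul_smul]
  rw [← neg_smul]
  congr 1
  ring

/-- Along the open hemisphere the radial field, read in `V`, IS the extension `capField`. [folklore] -/
theorem capField_capMapAmb (x : 𝔼) :
    capField v (capMapAmb v x) = (2 * (capRadius (n := n) x)⁻¹ ^ 3) • (capEmb v x + ‖x‖ ^ 2 • (v : V)) := by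
  rw [capField, inner_pole_capMapAmb, capMapAmb, capLift]
  have hρ := capRadius_pos (n := n) x
  have h2 : ‖x‖ ^ 2 = capRadius (n := n) x ^ 2 - 1 := by rw [capRadius_sq]; ring
  rw [h2]
  match_scalars
  · field_simp
  · ring

/-- Along the open hemisphere the radial field, read in `V` (`dι ∘ N`), IS the extension
`capField ∘ ι`. [folklore] -/
theorem mvfderiv_coe_capNormal_capMap (x : 𝔼) :
    mvfderiv (𝓡 (n + 1)) (Subtype.val : sphere (0 : V) 1 → V) (capMap v x)
      (capNormal v (capMap v x)) = capField v (capMapAmb (n := n) v x) := by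
  change mfderiv (𝓡 (n + 1)) 𝓘(ℝ, V) (Subtype.val : sphere (0 : V) 1 → V) (capMap v x)
      (capNormal v (capMap v x)) = _
  rw [capNormal_capMap, mfderiv_coe_mfderiv_capMap, capDeriv_two_smul_self, capField_capMapAmb]

/-- **The caps are umbilic: the covariant derivative of the radial field.** For the Levi-Civita
connection `∇` of the round metric, at a point `y` of the open hemisphere about `-v` and for every
tangent vector `a` with `dι(a) ⊥ v` (i.e. tangent to the parallel `⟪v, ·⟫ = const` through `y`),
`∇ₐ N = 2⟪v, y⟫² a`. Computed in the ambient space: `dι(∇ₐ N)` is the tangential part of the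
derivative of `ι_* N = capField ∘ ι` (`mvfderiv_coe_cov_apply_sphere`, Lee 2018, Prop. 5.12 (b)),
and `D(capField)_y (dι a) = 2⟪v, y⟫² dι a` is already tangent. [cite: Lee2018, Prop. 5.12 (b) and Example 4.9] -/
theorem leviCivita_capNormal [(roundMetric (n := n + 1) V).HasLeviCivita] {y : sphere (0 : V) 1}
    (hy : ⟪(v : V), y⟫ < 0) (a : TangentSpace (𝓡 (n + 1)) y)
    (ha : ⟪(v : V), mvfderiv (𝓡 (n + 1)) (Subtype.val : sphere (0 : V) 1 → V) y a⟫ = 0) :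
    (roundMetric (n := n + 1) V).leviCivita (capNormal (n := n) v) y a =
      (2 * ⟪(v : V), y⟫ ^ 2) • a := by
  have hN : ContMDiffAt (𝓡 (n + 1)) (𝓡 (n + 1)).tangent 2
      (fun y ↦ (TotalSpace.mk' 𝔼 y (capNormal (n := n) v y) :
        TangentBundle (𝓡 (n + 1)) (sphere (0 : V) 1))) y :=
    (contMDiffAt_capNormal v hy).of_le (by exact_mod_cast (show ((2 : ℕ) : ℕ∞ω) ≤ ∞ from WithTop.coe_le_coe.mpr le_top))
  have key := mvfderiv_coe_cov_apply_sphere (n := n + 1) (V := V)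
    (roundMetric (n := n + 1) V).isLeviCivita_leviCivita_holds hN a
  -- the lifted field `ι_* N` agrees with `capField ∘ ι` near `y`
  have hopen : IsOpen {y : sphere (0 : V) 1 | ⟪(v : V), y⟫ < 0} :=
    isOpen_lt (continuous_const.inner continuous_subtype_val) continuous_const
  -- hence its derivative along `a` is `2⟪v, y⟫² dι(a)`
  have heq : (fun y' : sphere (0 : V) 1 ↦ mvfderiv (𝓡 (n + 1))
      (Subtype.val : sphere (0 : V) 1 → V) y' (capNormal (n := n) v y')) =ᶠ[𝓝 y]
      fun y' ↦ capField v (y' : V) := by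
    filter_upwards [hopen.mem_nhds hy] with y' hy'
    obtain ⟨x', rfl⟩ := exists_capMap_eq (n := n) v hy'
    exact mvfderiv_coe_capNormal_capMap v x'
  have hD : mvfderiv (𝓡 (n + 1)) (fun y' : sphere (0 : V) 1 ↦ mvfderiv (𝓡 (n + 1))
      (Subtype.val : sphere (0 : V) 1 → V) y' (capNormal (n := n) v y')) y a =
      (2 * ⟪(v : V), y⟫ ^ 2) • mvfderiv (𝓡 (n + 1)) (Subtype.val : sphere (0 : V) 1 → V) y a := by
    rw [mvfderiv_congr_nhds heq]
    have hc : HasMFDerivAt (𝓡 (n + 1)) 𝓘(ℝ, V) (fun y' : sphere (0 : V) 1 ↦ capField v (y' : V)) y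
        ((fderiv ℝ (capField v) (y : V)).comp
          (mfderiv (𝓡 (n + 1)) 𝓘(ℝ, V) (Subtype.val : sphere (0 : V) 1 → V) y)) :=
      (hasFDerivAt_capField v (y : V)).differentiableAt.hasFDerivAt.hasMFDerivAt.comp y
        ((contMDiff_coe_sphere y).mdifferentiableAt one_ne_zero).hasMFDerivAt
    change mfderiv (𝓡 (n + 1)) 𝓘(ℝ, V) (fun y' : sphere (0 : V) 1 ↦ capField v (y' : V)) y a = _
    rw [hc.mfderiv]
    exact fderiv_capField_apply_of_inner_eq_zero v _ ha
  -- which is tangent, so equals `dι(∇ₐ N)`; conclude by injectivity of `dι`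
  have htan : ⟪(y : V), mvfderiv (𝓡 (n + 1)) (Subtype.val : sphere (0 : V) 1 → V) y a⟫ = 0 :=
    inner_coe_mvfderiv_coe_sphere y a
  apply mfderiv_coe_sphere_injective (n := n + 1) y
  rw [map_smul]
  change mvfderiv (𝓡 (n + 1)) (Subtype.val : sphere (0 : V) 1 → V) y
      ((roundMetric (n := n + 1) V).leviCivita (capNormal (n := n) v) y a) =
    (2 * ⟪(v : V), y⟫ ^ 2) • mvfderiv (𝓡 (n + 1)) (Subtype.val : sphere (0 : V) 1 → V) y a
  rw [key, hD, inner_smul_right, htan, mul_zero, zero_smul, sub_zero]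
  rfl

/-- The same at `y = Φ(x)`, where `2⟪v, y⟫² = 2ρ(x)⁻²` (`= 1` on the unit sphere `‖x‖ = 1`). [folklore] -/
theorem leviCivita_capNormal_capMap [(roundMetric (n := n + 1) V).HasLeviCivita] (x : 𝔼)
    (a : TangentSpace (𝓡 (n + 1)) (capMap (n := n) v x))
    (ha : ⟪(v : V), mvfderiv (𝓡 (n + 1)) (Subtype.val : sphere (0 : V) 1 → V) (capMap v x) a⟫ = 0) :
    (roundMetric (n := n + 1) V).leviCivita (capNormal (n := n) v) (capMap v x) a =
      (2 * (capRadius (n := n) x)⁻¹ ^ 2) • a := by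
  rw [leviCivita_capNormal v (inner_pole_capMapAmb_neg v x) a ha, coe_capMap, inner_pole_capMapAmb,
    neg_sq]

end Normal

/-! ### The covariant derivative of a restricted vector field along a map -/

section AlongMap

variable {EM : Type*} [NormedAddCommGroup EM] [NormedSpace ℝ EM] {HM : Type*} [TopologicalSpace HM]
  {IM : ModelWithCorners ℝ EM HM} {M : Type*} [TopologicalSpace M] [ChartedSpace HM M]
  [IsManifold IM ∞ M] [FiniteDimensional ℝ EM]
  {EN : Type*} [NormedAddCommGroup EN] [NormedSpace ℝ EN] {HN : Type*} [TopologicalSpace HN]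
  {IN : ModelWithCorners ℝ EN HN} {N : Type*} [TopologicalSpace N] [ChartedSpace HN N]
  [IsManifold IN ∞ N] {m : ℕ∞ω}
  (g : PseudoRiemannianMetric IM m EM (TangentSpace IM : M → Type _)) [g.HasLeviCivita]

/-- **`D_w (Y ∘ f) = ∇_{df w} Y`.** The covariant derivative along `f : N → M`, in the direction
`w ∈ T_y N` (at an interior point `y`), of the restriction `Y ∘ f` of a vector field `Y` of `M`
differentiable at `f y`, is the Levi-Civita covariant derivative of `Y` in the direction `df_y w`:
by definition `D_w (Y ∘ f) = D(Y ∘ f ∘ c)/dt (0)` for the chart-straight curve `c` with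
`c' 0 = w`, and `D(Y ∘ γ)/dt = ∇_{γ'} Y` (`covariantDerivAlong_comp_holds`) with
`(f ∘ c)' 0 = df (c' 0)`. O'Neill 1983, Ch. 3, Prop. 3.18 (3) and Ch. 4, Lemma 4.1.
[cite: ONeill1983, Ch. 3, Prop. 3.18 (3)] -/
theorem normalDerivAlong_comp_eq_leviCivita {f : N → M} {Y : Π x : M, TangentSpace IM x} {y : N}
    (hy : IN.IsInteriorPoint y) (hf : MDifferentiableAt IN IM f y)
    (hY : MDifferentiableAt IM IM.tangent
      (fun x ↦ (TotalSpace.mk' EM x (Y x) : TangentBundle IM M)) (f y))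
    (w : TangentSpace IN y) :
    g.normalDerivAlong f (fun x ↦ Y (f x)) y w = g.leviCivita Y (f y) (mfderiv IN IM f y w) := by
  have hc := mdifferentiableAt_curveThrough_zero hy w
  have hf' : MDifferentiableAt IN IM f (curveThrough IN y w 0) := by
    rw [curveThrough_zero]; exact hf
  have hY' : MDifferentiableAt IM IM.tangent
      (fun x ↦ (TotalSpace.mk' EM x (Y x) : TangentBundle IM M)) ((f ∘ curveThrough IN y w) 0) := by
    rw [comp_apply, curveThrough_zero]; exact hY
  have h := covariantDerivAlong_comp_holds g.leviCivita (γ := f ∘ curveThrough IN y w) (Y := Y)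
    (t₀ := 0) (hf'.comp 0 hc) hY'
  have hv : velocity IM (f ∘ curveThrough IN y w) 0 =
      mfderiv IN IM f (curveThrough IN y w 0) (velocity IN (curveThrough IN y w) 0) := by
    simp only [velocity]
    rw [mfderiv_comp 0 hf' hc]
    rfl
  rw [hv] at h
  simp only [comp_apply] at h
  rw [curveThrough_zero, velocity_curveThrough_zero_holds hy w] at h
  exact h

end AlongMap

end Literature.Geometry.Riemannian

end
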